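/-
Copyright (c) 2026 the pub-hodgecm-mathlib formalisation cell (harness21).  Prover seat hodgecm-mathlib-K2-defs1 (g6), Track B, h413 = `stmt-HodgeConjecture-24833`, route `HCCMUnconditional`,
deal (235)(a) of dealer K2E1-plan (g7) 2026-09-04T12:44:32Z (K2E1-p11's FILE 2, spec 12:25:59Z∕12:43:59Z; part 2c-B of my 12:53Z plan): convData_χ's `hfam`∕`hnc` for EVERY `(χ_∞, ω)`.
-/
import Summits.HodgeConjecture.HodgeConjecture.Theorems.K2E1ArchSymbolFormulaU2                  -- 📤 2c-A (this seat): Fubini for pure tensors, symbol formula, phase nbhd; brings 2a∕2b, ★ 12d-C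
import Summits.HodgeConjecture.HodgeConjecture.Theorems.K2E1ArchTestFunctionSymbolU2              -- ★ (174) P1 (this seat): `exists_entire_symbol_of_arch`
import Summits.HodgeConjecture.HodgeConjecture.Theorems.K2E1SymbolPositivitySecondDifference      -- ★ K2E1-p11 (g2) p860148: the two engines
import Summits.HodgeConjecture.HodgeConjecture.Theorems.K2E1BLUniquenessU2                        -- ★ `one_mem_closure_setOf_one_lt_borelHeight_two` (N = 2, `c² = 1`)
import HarnessLib

/-!
# (235)(a) FILE 2c-B — `K2E1ArchSymbolCirclePhaseU2`: convData_χ's LETTERS `hfam`∕`hnc` AT `V := chiSectionSpace χ K′ ω` FOR EVERY `(χ_∞, ω)` — the archimedean gauge test functions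
# `η_ψ = α_ψ ⊗ 𝟙_{U₀}` have self-convolutions acting on `V ⊗ H^z` by ENTIRE symbols `s_ψ` with `s_ψ(z₀) ≠ 0` (support shrunk to the phase-control neighbourhood) and `s_ψ` NON-CONSTANT

Cell `pub/hodgecm-mathlib`, crux H413 = `stmt-HodgeConjecture-24833`.  THEOREMS ONLY (no `def`, no `instance`, no notation, no named-fact hypothesis, no `sorry`); lane `--supports
stmt-HodgeConjecture-24833 --as helper` (count-neutral).  Closes no socket.  §1 generic `(F, E, c)`, every rank; §2–§3 at `N = 2` (`c² = 1`; the arch ray); §4 HEADS in the CM packaging of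
★ `K2E1ChiConvDataCMTwo.exists_chi_convData_cm_two` (K2E1-p14 R4 bytes).

THE MATHEMATICS ([Bump1997, proof of Lemma 2.3.2]; [BernsteinLapid2019, §4 Claim 1]; [Langlands1976, §6]; K2E1-p11's design 12:25:59Z).  For `φ₀ ∈ V` with `φ₀(k₀) ≠ 0`, `k₀ ∈ K` (Iwasawa), ★ 2c-A
gives `s(z) = ∫ w(a)·Φ(a)·R(a)^z dμ_∞` with a real weight `w = κκ′μ_f(U)²·(α∗α) ≥ 0` (`∫ w > 0`, `w ∈ C_c(G_∞)`), `Φ(a) = φ₀(k₀ιa)∕φ₀(k₀)`, `R(a) = H(k₀ιa)`.  §1: for `ψ.rOut` small the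
support of `α_ψ∗α_ψ` lies in the phase-control neighbourhood `{½ ≤ Re ΦR^{z₀}, ½ ≤ Re Φ}` (★ 2a `exists_forall_archBump_ne_zero_mem`, `supp(α∗α) ⊆ supp α·supp α`), so K2E1-p11's ★ engine
`integral_ne_zero_of_re_ge_half` gives `s(z₀) ≠ 0` and ★ `exists_apply_ne_apply_of_secondDiff` gives non-constancy once `μ_∞{w ≠ 0, R ≠ 1} > 0`; §2: at `N = 2` the arch ray
is replaced by ★ `one_mem_closure_setOf_one_lt_borelHeight_two` read through `g = ι(g_∞)ι_f(g_f)` on `{g_f ∈ GL₂(𝒪̂)}`: every nbhd of `1` in `G_∞` has `a` with `H(ι a) ≠ 1`; conjugating by `k_{0,∞}` puts it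
inside `{w ≠ 0}` with `R ≠ 1` (`H(k₀ι(k_∞⁻¹a k_∞)) = H(ι(a)k₀) = H(ι a)`).  §3 assembles the core; §4 the two heads.
* §1 `exists_rOut_forall_support_subset`.  * §2 `exists_mem_borelHeight_archToAdelic_ne_one_two`.  * §3 **`exists_gauge_symbol_two`** (core).  * §4 HEADS **`hfam_gauge_cm_two`**, **`hnc_gauge_cm_two`**.
HONEST LABEL: HC_CM is proved only modulo the 7 printed citations (2 remaining named inputs: hLiu418 = `stmt-HodgeConjecture-24832`, h413 = `stmt-HodgeConjecture-24833`) until rung 0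
closes; count-neutral helper, closes no socket.  Binders left to the consumer (all structural): `K′ ≤ K`, `ι(K_∞) ⊆ K′`, `U₀` open compact with `ι_f(U₀ ∩ G_f) ⊆ K′` and `ω = 1` there
(★ `K2E1AdelicIdentityNeighbourhoodBasisU` + ★ `exists_finCongruenceLevel_le_ker`), continuity of the sections in `V`, a two-sided Haar measure on `G_∞`.

## References
* [Bump1997] D. Bump, *Automorphic Forms and Representations* (1997), proof of Lemma 2.3.2.  * [BernsteinLapid2019] J. Bernstein, E. Lapid, *On the meromorphic continuation of Eisenstein
  series*, J. AMS 37 (2024), §4 Claim 1.  * [Langlands1976] R. P. Langlands, *On the Functional Equations Satisfied by Eisenstein Series*, LNM 544 (1976), §6.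
-/

set_option autoImplicit false
set_option linter.dupNamespace false  -- the mandated namespace repeats the summit's segment (`HodgeConjecture.HodgeConjecture`)

noncomputable section

open MeasureTheory Measure NumberField NumberField.mixedEmbedding IsDedekindDomain Set Filter Topology
open scoped NNReal MatrixGroups Classical Pointwise
open Literature.NumberTheory Literature.NumberTheory.Automorphic Literature.NumberTheory.Automorphic.UnitaryGroup AdelicGroupData
open Literature.NumberTheory.GaloisRepresentations (HeckeCharacter)
open Summit.HodgeConjecture.HodgeConjecture.Cruxes.H413.K2E1BorelEisensteinU
open Summit.HodgeConjecture.HodgeConjecture.Cruxes.H413.K2E1CharacterEisensteinU2Defs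
open Summit.HodgeConjecture.HodgeConjecture.Cruxes.H413.K2E1ChiSectionSpaceU2Defs
open Summit.HodgeConjecture.HodgeConjecture.Cruxes.H413.K2E1ArchPureTensorSelfConvolutionU2
open Summit.HodgeConjecture.HodgeConjecture.Cruxes.H413.K2E1ArchSymbolFormulaU2
open Summit.HodgeConjecture.HodgeConjecture.Cruxes.H413.K2E1ArchTestFunctionSymbolU2 (exists_entire_symbol_of_arch)
open Summit.HodgeConjecture.HodgeConjecture.Cruxes.H413.K2E1SymbolPositivitySecondDifference (integral_ne_zero_of_re_ge_half exists_apply_ne_apply_of_secondDiff)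
open Summit.HodgeConjecture.HodgeConjecture.Cruxes.H413.K2E1TruncatedCuspDecayHNU2 (orbitalSmoothing_self_eq_zero)
open Summit.HodgeConjecture.HodgeConjecture.Cruxes.H413.K2E1BLSelfConvolutionU2 (continuous_selfConv hasCompactSupport_selfConv)
open Summit.HodgeConjecture.HodgeConjecture.Cruxes.H413.K2E1BLUniquenessU2 (one_mem_closure_setOf_one_lt_borelHeight_two)
open Summit.HodgeConjecture.HodgeConjecture.Cruxes.H413.K2E1SphericalHeckeEigenSectionU2 (continuous_borelHeight_coe borelHeight_eq_one_of_mem)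

namespace Summit.HodgeConjecture.HodgeConjecture.Cruxes.H413.K2E1ArchSymbolCirclePhaseU2

/-! ## §1 Support control: for small `ψ.rOut` the support of `α_ψ ∗ α_ψ` lies in a prescribed neighbourhood of `1` in `G_∞` -/

section Support

variable {F E : Type} [Field F] [NumberField F] [Field E] [NumberField E] [Algebra F E] {c : E ≃ₐ[F] E} {N : ℕ}
variable [MeasurableSpace (arch F E c N ((StdForm.antidiagonal N).over E))] (μa : Measure (arch F E c N ((StdForm.antidiagonal N).over E)))

omit [NumberField F] in
/-- **SUPPORT CONTROL**: for `W ∈ 𝓝 1` in `G_∞` there is `r > 0` such that for every bump `ψ` with `ψ.rOut ≤ r`, `∫ α_ψ(x)α_ψ(x⁻¹a) dμ_∞ ≠ 0 ⟹ a ∈ W` (`V·V ⊆ W` with `V` open, a closed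
neighbourhood `C ⊆ V`, ★ 2a `exists_forall_archBump_ne_zero_mem` for the trace of `C` on `GL_N(E ⊗ ℝ)`, `supp(α∗α) ⊆ tsupport α·tsupport α`). [cite: Bump1997, proof of Lemma 2.3.2] -/
theorem exists_rOut_forall_support_subset {W : Set (arch F E c N ((StdForm.antidiagonal N).over E))} (hW : W ∈ 𝓝 (1 : arch F E c N ((StdForm.antidiagonal N).over E))) :
    ∃ r : ℝ, 0 < r ∧ ∀ ψ : ContDiffBump (0 : ℝ), ψ.rOut ≤ r → ∀ a : arch F E c N ((StdForm.antidiagonal N).over E),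
      (∫ x, ((archBump ψ ((x : arch F E c N ((StdForm.antidiagonal N).over E)) : GL (Fin N) (mixedSpace E)) : ℝ) : ℂ) *
        ((archBump ψ ((x⁻¹ * a : arch F E c N ((StdForm.antidiagonal N).over E)) : GL (Fin N) (mixedSpace E)) : ℝ) : ℂ) ∂μa) ≠ 0 → a ∈ W := by
  obtain ⟨V, hVo, h1V, hVV⟩ := exists_open_nhds_one_mul_subset hW
  obtain ⟨C, hC, hCc, hCV⟩ := exists_mem_nhds_isClosed_subset (hVo.mem_nhds h1V)
  have hC' : C ∈ comap (Subtype.val : arch F E c N ((StdForm.antidiagonal N).over E) → GL (Fin N) (mixedSpace E)) (𝓝 1) := by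
    rw [← OneMemClass.coe_one (arch F E c N ((StdForm.antidiagonal N).over E)), ← nhds_subtype]; exact hC
  obtain ⟨WG, hWG, hWGC⟩ := mem_comap.1 hC'
  obtain ⟨r, hr, hrW⟩ := exists_forall_archBump_ne_zero_mem (n := N) (K := E) hWG
  refine ⟨r, hr, fun ψ hψ a ha => ?_⟩
  have hts : tsupport (fun x : arch F E c N ((StdForm.antidiagonal N).over E) => ((archBump ψ ((x : arch F E c N ((StdForm.antidiagonal N).over E)) : GL (Fin N) (mixedSpace E)) : ℝ) : ℂ)) ⊆ V :=
    (closure_minimal (fun x hx => hWGC (hrW ψ hψ _ fun h0 => (Function.mem_support.1 hx) (by simp only [h0, Complex.ofReal_zero]))) hCc).trans hCV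
  by_contra haW
  refine ha (orbitalSmoothing_self_eq_zero (ν := μa) fun hmem => haW (hVV ?_))
  exact Set.mul_subset_mul hts hts hmem

omit [NumberField F] in
/-- `∫ α_ψ(x)α_ψ(x⁻¹a) dμ_∞ ≠ 0 ⟹ a ∈ tsupport α_ψ · tsupport α_ψ` (★ `orbitalSmoothing_self_eq_zero`). [folklore] -/
theorem mem_tsupport_mul_of_integral_ne_zero (ψ : ContDiffBump (0 : ℝ)) {a : arch F E c N ((StdForm.antidiagonal N).over E)}
    (ha : (∫ x, ((archBump ψ ((x : arch F E c N ((StdForm.antidiagonal N).over E)) : GL (Fin N) (mixedSpace E)) : ℝ) : ℂ) *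
        ((archBump ψ ((x⁻¹ * a : arch F E c N ((StdForm.antidiagonal N).over E)) : GL (Fin N) (mixedSpace E)) : ℝ) : ℂ) ∂μa) ≠ 0) :
    a ∈ tsupport (fun x : arch F E c N ((StdForm.antidiagonal N).over E) => ((archBump ψ ((x : arch F E c N ((StdForm.antidiagonal N).over E)) : GL (Fin N) (mixedSpace E)) : ℝ) : ℂ)) *
      tsupport (fun x : arch F E c N ((StdForm.antidiagonal N).over E) => ((archBump ψ ((x : arch F E c N ((StdForm.antidiagonal N).over E)) : GL (Fin N) (mixedSpace E)) : ℝ) : ℂ)) := by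
  by_contra h
  exact ha (orbitalSmoothing_self_eq_zero (ν := μa) h)

end Support

/-! ## §2 `N = 2`: points `a` of `G_∞` arbitrarily close to `1` with `H(ι a) ≠ 1` -/

section Ray

variable {F E : Type} [Field F] [NumberField F] [Field E] [NumberField E] [Algebra F E] {c : E ≃ₐ[F] E}

/-- **`1 ∈ closure {a ∈ G_∞ | H(ι a) ≠ 1}` AT `N = 2`**: every neighbourhood `O` of `1` in `G_∞` contains `a` with `H(ι a) ≠ 1`.  From ★ `one_mem_closure_setOf_one_lt_borelHeight_two` (`c² = 1`) applied to the
open neighbourhood `{g | g_∞ ∈ O, g_f ∈ GL₂(𝒪̂_E)}` of `1` in `G(𝔸)`: such `g = ι(g_∞)·ι_f(g_f)` has `ι_f(g_f) ∈ K`, so `H(ι g_∞) = H(g) > 1`. [cite: BernsteinLapid2019, §4 Claim 2] -/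
theorem exists_mem_borelHeight_archToAdelic_ne_one_two (hc : c * c = 1) {O : Set (arch F E c 2 ((StdForm.antidiagonal 2).over E))}
    (hO : O ∈ 𝓝 (1 : arch F E c 2 ((StdForm.antidiagonal 2).over E))) :
    ∃ a ∈ O, borelHeight (archToAdelic F E c 2 ((StdForm.antidiagonal 2).over E) a) ≠ 1 := by
  -- the open neighbourhood `M = {g | g_∞ ∈ O, (val g)_f ∈ GL₂(𝒪̂_E)}` of `1` in `G(𝔸)`
  have hemb : IsClosedEmbedding (adelicVal F E c 2 ((StdForm.antidiagonal 2).over E)) := (isClosed_adelic F E c 2 ((StdForm.antidiagonal 2).over E)).isClosedEmbedding_subtypeVal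
  have hsndc : Continuous fun x : (quasiSplit F E c 2).Adelic => GLn.sndHom 2 E (adelicVal F E c 2 ((StdForm.antidiagonal 2).over E) x) :=
    (GLn.continuous_sndHom (n := 2) (K := E)).comp hemb.continuous
  set M : Set (quasiSplit F E c 2).Adelic := (archPart F E c 2 ((StdForm.antidiagonal 2).over E)) ⁻¹' O ∩
    {g | GLn.sndHom 2 E (adelicVal F E c 2 ((StdForm.antidiagonal 2).over E) g) ∈ glFiniteIntegralLevel 2 E} with hM
  have hM1 : M ∈ 𝓝 (1 : (quasiSplit F E c 2).Adelic) := by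
    refine Filter.inter_mem ((continuous_archPart F E c 2 _).continuousAt.preimage_mem_nhds (by rw [map_one]; exact hO)) ?_
    exact ((isOpen_glFiniteIntegralLevel 2 E).preimage hsndc).mem_nhds (by
      show GLn.sndHom 2 E (adelicVal F E c 2 ((StdForm.antidiagonal 2).over E) 1) ∈ glFiniteIntegralLevel 2 E
      rw [map_one, map_one]; exact (glFiniteIntegralLevel 2 E).one_mem)
  obtain ⟨g, hgM, hgH⟩ := mem_closure_iff_nhds.1 (one_mem_closure_setOf_one_lt_borelHeight_two (F := F) (E := E) (c := c) hc) M hM1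
  refine ⟨archPart F E c 2 _ g, hgM.1, ?_⟩
  -- `g = ι(g_∞)·ι_f(g_f)` with `ι_f(g_f) ∈ K`, so `H(ι g_∞) = H(g) > 1`
  have hk : finAdelicToAdelic F E c 2 ((StdForm.antidiagonal 2).over E) (finPart F E c 2 _ g) ∈
      (((standardMaximalCompactGL 2 E).comap (adelicVal F E c 2 ((StdForm.antidiagonal 2).over E)) : Subgroup (quasiSplit F E c 2).Adelic)) := by
    refine Subgroup.mem_comap.2 ((mem_standardMaximalCompactGL_iff_toMixed_sndHom _).2 ⟨?_, ?_⟩)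
    · rw [← coe_archPart, archPart_finAdelicToAdelic]
      exact (Kinf 2 E).one_mem
    · rw [← coe_finPart, finPart_finAdelicToAdelic]
      exact hgM.2
  have e : borelHeight (archToAdelic F E c 2 ((StdForm.antidiagonal 2).over E) (archPart F E c 2 _ g)) = borelHeight g := by
    conv_rhs => rw [← archToAdelic_mul_finAdelicToAdelic F E c 2 ((StdForm.antidiagonal 2).over E) g]
    rw [borelHeight_mul_of_mem_comap_standardMaximalCompactGL hk]
  rw [e]
  exact ne_of_gt hgH

end Ray

/-! ## §3 CORE (`N = 2`): a gauge test function whose symbol on `V(χ, K′, ω)` is entire, `≠ 0` at `z₀`, and non-constant -/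

section Core

variable {F E : Type} [Field F] [NumberField F] [Field E] [NumberField E] [Algebra F E] [Algebra.IsQuadraticExtension F E] {c : E ≃ₐ[F] E}
variable [MeasurableSpace (quasiSplit F E c 2).Adelic] [BorelSpace (quasiSplit F E c 2).Adelic]
variable [MeasurableSpace (arch F E c 2 ((StdForm.antidiagonal 2).over E))] [BorelSpace (arch F E c 2 ((StdForm.antidiagonal 2).over E))]
variable [MeasurableSpace (finAdelic F E c 2 ((StdForm.antidiagonal 2).over E))] [BorelSpace (finAdelic F E c 2 ((StdForm.antidiagonal 2).over E))]
variable (νG : Measure (quasiSplit F E c 2).Adelic) [νG.IsHaarMeasure]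
variable (μa : Measure (arch F E c 2 ((StdForm.antidiagonal 2).over E))) [μa.IsHaarMeasure] [μa.IsMulRightInvariant]
variable (μf : Measure (finAdelic F E c 2 ((StdForm.antidiagonal 2).over E))) [μf.IsHaarMeasure]
variable {χ : HeckeCharacter E} {K' : Subgroup (quasiSplit F E c 2).Adelic} {ω : ↥K' → ℂ}

set_option maxHeartbeats 400000 in
include μa μf in
/-- **CORE**: for `c ≠ 1` with `c² = 1` fixing the infinite places, `K′ ≤ K` containing `ι(K_∞)`, an open compact `U₀ ≤ GL₂(𝔸_E^∞)` with `ι_f(U₀ ∩ G_f) ⊆ K′` acting trivially, continuous sections, and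
any `z₀`: some gauge test function `η_ψ = α_ψ ⊗ 𝟙_{U₀}` has an ENTIRE symbol `s` on `V(χ, K′, ω)` (`∫ S_{η̃}η̃·f_z^φ(x·) = s(z)f_z^φ(x)`) with `s(z₀) ≠ 0` and `s` NON-CONSTANT.
[cite: Bump1997, proof of Lemma 2.3.2] [cite: BernsteinLapid2019, §4 Claim 1] [cite: Langlands1976, §6] -/
theorem exists_gauge_symbol_two (hc : c ≠ 1) (hc2 : c * c = 1) (hfix : ∀ w : InfinitePlace E, c • w = w)
    (hK' : K' ≤ ((standardMaximalCompactGL 2 E).comap (adelicVal F E c 2 ((StdForm.antidiagonal 2).over E)) : Subgroup (quasiSplit F E c 2).Adelic))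
    (hKinf : ∀ k : arch F E c 2 ((StdForm.antidiagonal 2).over E), adelicVal F E c 2 ((StdForm.antidiagonal 2).over E) (archToAdelic F E c 2 _ k) ∈ standardMaximalCompactGL 2 E → archToAdelic F E c 2 _ k ∈ K')
    (U₀ : Subgroup (GL (Fin 2) (FiniteAdeleRing (𝓞 E) E))) (hU₀o : IsOpen (U₀ : Set (GL (Fin 2) (FiniteAdeleRing (𝓞 E) E)))) (hU₀c : IsCompact (U₀ : Set (GL (Fin 2) (FiniteAdeleRing (𝓞 E) E))))
    (hU : ∀ b : finAdelic F E c 2 ((StdForm.antidiagonal 2).over E), (b : GL (Fin 2) (FiniteAdeleRing (𝓞 E) E)) ∈ U₀ → ∃ hb : finAdelicToAdelic F E c 2 ((StdForm.antidiagonal 2).over E) b ∈ K', ω ⟨_, hb⟩ = 1)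
    (hVc : ∀ φ ∈ chiSectionSpace χ K' ω, Continuous φ) (z₀ : ℂ) :
    ∃ ψ : ContDiffBump (0 : ℝ), ∃ s : ℂ → ℂ, Differentiable ℂ s ∧ s z₀ ≠ 0 ∧ (∃ z₁ z₂ : ℂ, s z₁ ≠ s z₂) ∧
      ∀ z : ℂ, ∀ φ ∈ chiSectionSpace χ K' ω, ∀ x : (quasiSplit F E c 2).Adelic,
        (∫ y, (fun y : (quasiSplit F E c 2).Adelic => orbitalSmoothing νG
            (fun x : (quasiSplit F E c 2).Adelic => (((adelicWeight U₀ (archBump ψ) (adelicVal F E c 2 ((StdForm.antidiagonal 2).over E) x)) : ℝ) : ℂ))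
            (fun x : (quasiSplit F E c 2).Adelic => (((adelicWeight U₀ (archBump ψ) (adelicVal F E c 2 ((StdForm.antidiagonal 2).over E) x)) : ℝ) : ℂ)) y) y *
          flatSectionU φ z (x * y) ∂νG) = s z * flatSectionU φ z x := by
  by_cases hV : ∃ φ₀ ∈ chiSectionSpace χ K' ω, ∃ x₁ : (quasiSplit F E c 2).Adelic, φ₀ x₁ ≠ 0
  swap
  · -- degenerate case: every section vanishes identically
    push Not at hV
    refine ⟨⟨1, 2, one_pos, one_lt_two⟩, fun z => z - z₀ + 1, (differentiable_id.sub_const z₀).add_const 1, by simp only [sub_self, zero_add, ne_eq, one_ne_zero, not_false_eq_true],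
      ⟨1, 0, fun h => one_ne_zero (by linear_combination h)⟩, fun z φ hφ x => ?_⟩
    have hφ0 : φ = 0 := funext fun y => hV φ hφ y
    subst hφ0
    have h0 : ∀ y, flatSectionU (0 : (quasiSplit F E c 2).Adelic → ℂ) z y = 0 := fun y => by rw [flatSectionU_apply, Pi.zero_apply, zero_mul]
    simp only [h0, mul_zero, integral_zero]
  obtain ⟨φ₀, hφ₀, x₁, hx₁⟩ := hV
  -- a point of `K` where `φ₀` does not vanish
  obtain ⟨b, hb, k₀, hk₀K, rfl⟩ := exists_mem_borelAdelic_mul_mem_standardMaximalCompactGL c hc hfix x₁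
  have hk₀ : φ₀ k₀ ≠ 0 := by
    intro h0; apply hx₁
    rw [((mem_chiSectionSpace_iff _).1 hφ₀).1 b hb k₀, h0, mul_zero]
  have hk₀K' : k₀ ∈ (((standardMaximalCompactGL 2 E).comap (adelicVal F E c 2 ((StdForm.antidiagonal 2).over E))) : Subgroup (quasiSplit F E c 2).Adelic) := Subgroup.mem_comap.2 hk₀K
  have hHk₀ : ((borelHeight k₀ : ℝ≥0) : ℝ) = 1 := by rw [borelHeight_eq_one_of_mem hk₀K, NNReal.coe_one]
  -- the phase-control neighbourhood and the bump radius
  have hW := setOf_half_le_re_mem_nhds_one (hVc φ₀ hφ₀) hk₀ z₀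
  obtain ⟨r, hr, hrW⟩ := exists_rOut_forall_support_subset μa hW
  let ψ : ContDiffBump (0 : ℝ) := ⟨r / 2, r, half_pos hr, half_lt_self hr⟩
  have hψr : ψ.rOut = r := rfl
  -- the test function, its pull-back and its self-convolution
  have hηT : IsTestFunctionGL 2 E (adelicWeight U₀ (archBump ψ)) := isTestFunctionGL_gaugeWeight ψ U₀ hU₀o hU₀c
  have hemb : IsClosedEmbedding (adelicVal F E c 2 ((StdForm.antidiagonal 2).over E)) := (isClosed_adelic F E c 2 ((StdForm.antidiagonal 2).over E)).isClosedEmbedding_subtypeVal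
  set ηt : (quasiSplit F E c 2).Adelic → ℂ := fun x => (((adelicWeight U₀ (archBump ψ) (adelicVal F E c 2 ((StdForm.antidiagonal 2).over E) x)) : ℝ) : ℂ) with hηt
  have hηc : Continuous ηt := Complex.continuous_ofReal.comp (hηT.continuous.comp hemb.continuous)
  have hηs : HasCompactSupport ηt := (hηT.hasCompactSupport.comp_isClosedEmbedding hemb).comp_left Complex.ofReal_zero
  set h : (quasiSplit F E c 2).Adelic → ℂ := fun y => orbitalSmoothing νG ηt ηt y with hh
  have hhc : Continuous h := continuous_selfConv νG hηc hηs
  have hhs : HasCompactSupport h := hasCompactSupport_selfConv νG hηs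
  -- the pure-tensor shape (★ 2b) and 12d-C's binders
  obtain ⟨κ₁, hκ₁, hten⟩ := selfConv_gaugeWeight_eq_pureTensor νG μa μf ψ U₀ hU₀o
  set U : Set (finAdelic F E c 2 ((StdForm.antidiagonal 2).over E)) := ↑(U₀.subgroupOf (finAdelic F E c 2 ((StdForm.antidiagonal 2).over E))) with hUdef
  set αψ : arch F E c 2 ((StdForm.antidiagonal 2).over E) → ℂ := fun x => ((archBump ψ ((x : arch F E c 2 ((StdForm.antidiagonal 2).over E)) : GL (Fin 2) (mixedSpace E)) : ℝ) : ℂ) with hαψ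
  set hinf : arch F E c 2 ((StdForm.antidiagonal 2).over E) → ℂ := fun a => ((κ₁ : ℝ) : ℂ) * (μf.real U : ℂ) * ∫ x, αψ x * αψ (x⁻¹ * a) ∂μa with hhinf
  have hten' : ∀ y, h y = hinf (archPart F E c 2 _ y) * U.indicator (fun _ => (1 : ℂ)) (finPart F E c 2 _ y) := hten
  have hUm : MeasurableSet U := (hU₀o.preimage continuous_subtype_val).measurableSet
  have hU' : ∀ b ∈ U, ∃ hb : finAdelicToAdelic F E c 2 ((StdForm.antidiagonal 2).over E) b ∈ K', ω ⟨_, hb⟩ = 1 := fun b hb => hU b (Subgroup.mem_subgroupOf.1 hb)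
  have hcent : ∀ k ∈ (((standardMaximalCompactGL 2 E).comap (adelicVal F E c 2 ((StdForm.antidiagonal 2).over E))).comap (archToAdelic F E c 2 ((StdForm.antidiagonal 2).over E))), ∀ y, hinf (k⁻¹ * y * k) = hinf y :=
    fun k hk y => archSelfConv_conj μa ψ (((κ₁ : ℝ) : ℂ) * (μf.real U : ℂ)) hk y
  -- ★ P1: one entire symbol with the action clause; ★ 2c-A: its integral formula at `(φ₀, k₀)`
  obtain ⟨s, hsd, hact⟩ := exists_entire_symbol_of_arch νG μa μf hc hfix hK' hKinf hhc hhs hten' hcent hU' hVc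
  obtain ⟨κ₂, hκ₂, hform⟩ := symbol_eq_integral_arch νG μa μf hK' hUm hten' hU' hact hφ₀ hk₀
  -- the phase `Φ`, the ratio `R > 0`, and the REAL weight `w ≥ 0` with `s z = ∫ w·Φ·R^z`
  set Φ : arch F E c 2 ((StdForm.antidiagonal 2).over E) → ℂ := fun a => φ₀ (k₀ * archToAdelic F E c 2 _ a) / φ₀ k₀ with hΦ
  set R : arch F E c 2 ((StdForm.antidiagonal 2).over E) → ℝ := fun a => ((borelHeight (k₀ * archToAdelic F E c 2 _ a) : ℝ≥0) : ℝ) / ((borelHeight k₀ : ℝ≥0) : ℝ) with hR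
  have hRpos : ∀ a, 0 < R a := fun a => ratio_pos k₀ a
  have hΦc : Continuous Φ := continuous_phase (hVc φ₀ hφ₀) k₀
  have hRc : Continuous R := continuous_ratio (F := F) (E := E) (c := c) (N := 2) k₀
  have hRzc : ∀ z : ℂ, Continuous fun a => (((R a : ℝ)) : ℂ) ^ z := fun z =>
    Continuous.cpow (Complex.continuous_ofReal.comp hRc) continuous_const fun a => Or.inl (by exact_mod_cast hRpos a)
  set w : arch F E c 2 ((StdForm.antidiagonal 2).over E) → ℝ := fun a => ((κ₂ : ℝ) * μf.real U) * (((κ₁ : ℝ) * μf.real U) *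
    ∫ x, archBump ψ ((x : arch F E c 2 ((StdForm.antidiagonal 2).over E)) : GL (Fin 2) (mixedSpace E)) * archBump ψ ((x⁻¹ * a : arch F E c 2 ((StdForm.antidiagonal 2).over E)) : GL (Fin 2) (mixedSpace E)) ∂μa) with hw
  have hhinf_eq : ∀ a, hinf a = ((((κ₁ : ℝ) * μf.real U) * ∫ x, archBump ψ ((x : arch F E c 2 ((StdForm.antidiagonal 2).over E)) : GL (Fin 2) (mixedSpace E)) *
      archBump ψ ((x⁻¹ * a : arch F E c 2 ((StdForm.antidiagonal 2).over E)) : GL (Fin 2) (mixedSpace E)) ∂μa : ℝ) : ℂ) := fun a => by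
    simp only [hhinf, hαψ, integral_archBump_mul_eq_ofReal μa ψ a]; push_cast; ring
  have hw_eq : ∀ a, ((w a : ℝ) : ℂ) = ((κ₂ : ℝ) : ℂ) * (μf.real U : ℂ) * hinf a := fun a => by
    rw [hhinf_eq]; simp only [hw]; push_cast; ring
  have hs_formula : ∀ z : ℂ, s z = ∫ a, ((w a : ℝ) : ℂ) * (Φ a * (((R a : ℝ)) : ℂ) ^ z) ∂μa := fun z => by
    rw [hform z, ← integral_const_mul]
    refine integral_congr_ae (Eventually.of_forall fun a => ?_)
    simp only [hw_eq, hΦ, hR, mul_assoc]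
  -- properties of `w`: `≥ 0`, `= κ₂μ_f(U)·Re h(ι ·)` hence continuous, compactly supported, positive integral
  have hw0 : ∀ a, 0 ≤ w a := fun a =>
    mul_nonneg (mul_nonneg κ₂.2 measureReal_nonneg) (mul_nonneg (mul_nonneg κ₁.2 measureReal_nonneg) (integral_archBump_mul_nonneg μa ψ a))
  have h1U : (1 : finAdelic F E c 2 ((StdForm.antidiagonal 2).over E)) ∈ U := (U₀.subgroupOf (finAdelic F E c 2 ((StdForm.antidiagonal 2).over E))).one_mem
  have hhinf_cont : Continuous hinf := by
    have e : hinf = fun a => h (archToAdelic F E c 2 _ a) := by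
      funext a
      rw [hten', archPart_archToAdelic, finPart_archToAdelic, Set.indicator_of_mem h1U, mul_one]
    rw [e]; exact hhc.comp (continuous_archToAdelic F E c 2 _)
  have hwc : Continuous w := by
    have e : w = fun a => (((κ₂ : ℝ) : ℂ) * (μf.real U : ℂ) * hinf a).re := by
      funext a; rw [← hw_eq, Complex.ofReal_re]
    rw [e]; exact Complex.continuous_re.comp (continuous_const.mul hhinf_cont)
  have hαs : HasCompactSupport αψ := by
    have e : αψ = Complex.ofReal ∘ fun x : arch F E c 2 ((StdForm.antidiagonal 2).over E) => archBump ψ ((x : arch F E c 2 ((StdForm.antidiagonal 2).over E)) : GL (Fin 2) (mixedSpace E)) := rfl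
    rw [e]
    exact HasCompactSupport.comp_left (hasCompactSupport_archBump_coe (F := F) (c := c) (N := 2) ψ) Complex.ofReal_zero
  have hw_supp : ∀ a, w a ≠ 0 → (∫ x, αψ x * αψ (x⁻¹ * a) ∂μa) ≠ 0 := by
    intro a ha h0
    apply ha
    have e := hw_eq a
    simp only [hhinf, h0, mul_zero] at e
    exact_mod_cast e
  have hws : HasCompactSupport w :=
    HasCompactSupport.of_support_subset_isCompact (hαs.isCompact.mul hαs.isCompact) fun a ha => mem_tsupport_mul_of_integral_ne_zero μa ψ (hw_supp a ha)
  have hwi : Integrable w μa := hwc.integrable_of_hasCompactSupport hws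
  have hwsC : HasCompactSupport fun a => ((w a : ℝ) : ℂ) := by
    have e : (fun a => ((w a : ℝ) : ℂ)) = Complex.ofReal ∘ w := rfl
    rw [e]; exact HasCompactSupport.comp_left hws Complex.ofReal_zero
  have hIc : ∀ G : arch F E c 2 ((StdForm.antidiagonal 2).over E) → ℂ, Continuous G → Integrable (fun a => ((w a : ℝ) : ℂ) * G a) μa := fun G hG =>
    ((Complex.continuous_ofReal.comp hwc).mul hG).integrable_of_hasCompactSupport hwsC.mul_right
  have hIr : ∀ G : arch F E c 2 ((StdForm.antidiagonal 2).over E) → ℝ, Continuous G → Integrable (fun a => w a * G a) μa := fun G hG =>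
    (hwc.mul hG).integrable_of_hasCompactSupport (hws.mul_right)
  have hUpos : 0 < μf.real U := by
    have hUo : IsOpen U := hU₀o.preimage continuous_subtype_val
    have hUc : IsCompact U := (isClosed_finAdelic F E c 2 ((StdForm.antidiagonal 2).over E)).isClosedEmbedding_subtypeVal.isCompact_preimage hU₀c
    exact ENNReal.toReal_pos (hUo.measure_ne_zero μf ⟨1, h1U⟩) hUc.measure_lt_top.ne
  have hw1 : w 1 ≠ 0 := ne_of_gt (mul_pos (mul_pos hκ₂ hUpos) (mul_pos (mul_pos hκ₁ hUpos) (integral_archBump_mul_one_pos μa ψ)))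
  have hpos : 0 < ∫ a, w a ∂μa := hwc.integral_pos_of_hasCompactSupport_nonneg_nonzero hws hw0 hw1
  -- phase control on the support of `w`
  have hWmem : ∀ a, w a ≠ 0 → (1 / 2 : ℝ) ≤ (Φ a * (((R a : ℝ)) : ℂ) ^ z₀).re ∧ (1 / 2 : ℝ) ≤ (Φ a).re := fun a ha =>
    hrW ψ (le_of_eq hψr) a (hw_supp a ha)
  -- (1) `s(z₀) ≠ 0`
  have hs0 : s z₀ ≠ 0 := by
    rw [hs_formula z₀]
    exact integral_ne_zero_of_re_ge_half μa hw0 (fun a ha => (hWmem a ha).1) hwi (hIc _ (hΦc.mul (hRzc z₀))) hpos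
  -- (2) non-constancy: the set `{w ≠ 0, R ≠ 1}` has positive measure (the arch ray through `k_{0,∞}`)
  have hch : μa {a | w a ≠ 0 ∧ R a ≠ 1} ≠ 0 := by
    set kinf : arch F E c 2 ((StdForm.antidiagonal 2).over E) := archPart F E c 2 _ k₀ with hkinf
    have hO : {a' : arch F E c 2 ((StdForm.antidiagonal 2).over E) | w (kinf⁻¹ * a' * kinf) ≠ 0} ∈ 𝓝 (1 : arch F E c 2 ((StdForm.antidiagonal 2).over E)) :=
      (isOpen_ne_fun (hwc.comp ((continuous_const.mul continuous_id).mul continuous_const)) continuous_const).mem_nhds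
        (by show w (kinf⁻¹ * 1 * kinf) ≠ 0; rwa [mul_one, inv_mul_cancel])
    obtain ⟨a', ha', hH'⟩ := exists_mem_borelHeight_archToAdelic_ne_one_two hc2 hO
    have hR' : R (kinf⁻¹ * a' * kinf) ≠ 1 := by
      have hd : k₀ = archToAdelic F E c 2 _ kinf * finAdelicToAdelic F E c 2 _ (finPart F E c 2 _ k₀) :=
        (archToAdelic_mul_finAdelicToAdelic F E c 2 ((StdForm.antidiagonal 2).over E) k₀).symm
      have hc' : finAdelicToAdelic F E c 2 _ (finPart F E c 2 _ k₀) * archToAdelic F E c 2 _ (kinf⁻¹ * a' * kinf) =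
          archToAdelic F E c 2 _ (kinf⁻¹ * a' * kinf) * finAdelicToAdelic F E c 2 _ (finPart F E c 2 _ k₀) :=
        (commute_archToAdelic_finAdelicToAdelic F E c 2 _ (kinf⁻¹ * a' * kinf) (finPart F E c 2 _ k₀)).eq.symm
      have ek : k₀ * archToAdelic F E c 2 _ (kinf⁻¹ * a' * kinf) = archToAdelic F E c 2 _ a' * k₀ := by
        calc k₀ * archToAdelic F E c 2 _ (kinf⁻¹ * a' * kinf)
            = archToAdelic F E c 2 _ kinf * (finAdelicToAdelic F E c 2 _ (finPart F E c 2 _ k₀) * archToAdelic F E c 2 _ (kinf⁻¹ * a' * kinf)) := by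
              conv_lhs => rw [hd]
              rw [mul_assoc]
          _ = archToAdelic F E c 2 _ (kinf * (kinf⁻¹ * a' * kinf)) * finAdelicToAdelic F E c 2 _ (finPart F E c 2 _ k₀) := by rw [hc', ← mul_assoc, ← map_mul]
          _ = archToAdelic F E c 2 _ (a' * kinf) * finAdelicToAdelic F E c 2 _ (finPart F E c 2 _ k₀) := by
              rw [show kinf * (kinf⁻¹ * a' * kinf) = a' * kinf by group]
          _ = archToAdelic F E c 2 _ a' * k₀ := by rw [map_mul, mul_assoc, ← hd]
      show ((borelHeight (k₀ * archToAdelic F E c 2 _ (kinf⁻¹ * a' * kinf)) : ℝ≥0) : ℝ) / ((borelHeight k₀ : ℝ≥0) : ℝ) ≠ 1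
      rw [ek, borelHeight_mul_of_mem_comap_standardMaximalCompactGL hk₀K', hHk₀, div_one, Ne, NNReal.coe_eq_one]
      exact hH'
    have hmem : kinf⁻¹ * a' * kinf ∈ ({a | w a ≠ 0} ∩ {a | R a ≠ 1} : Set (arch F E c 2 ((StdForm.antidiagonal 2).over E))) := ⟨ha', hR'⟩
    rw [Set.setOf_and]
    exact ((isOpen_ne_fun hwc continuous_const).inter (isOpen_ne_fun hRc continuous_const)).measure_ne_zero μa ⟨_, hmem⟩
  have hnc : ∃ z₁ z₂ : ℂ, s z₁ ≠ s z₂ := by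
    refine exists_apply_ne_apply_of_secondDiff μa hw0 hRpos (fun a ha => (hWmem a ha).2) 0 (s := s) (fun z _ => ?_) (hIc _ (hΦc.mul (hRzc _)))
      (hIc _ (hΦc.mul (hRzc _))) (hIc _ (hΦc.mul (hRzc _))) (hIr _ ?_) (hIc _ (hΦc.mul ((hRzc _).mul ((Complex.continuous_ofReal.comp hRc).sub continuous_const |>.pow 2)))) hch
    · exact hs_formula z
    · exact (hRc.rpow_const fun a => Or.inl (hRpos a).ne').mul ((hRc.sub continuous_const).pow 2)
  refine ⟨ψ, s, hsd, hs0, hnc, fun z φ hφ x => ?_⟩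
  have e := hact z φ hφ x
  simp only [hh, hηt] at e
  exact e

end Core

/-! ## §4 HEADS (CM, `N = 2`): convData_χ's `hfam`∕`hnc` at `V := chiSectionSpace χ K′ ω`, every `(χ_∞, ω)` -/

section Heads

variable (L : Type) [Field L] [NumberField L] [IsCMField L]
variable [MeasurableSpace (quasiSplit (↥(maximalRealSubfield L)) L (IsCMField.complexConj L) 2).Adelic] [BorelSpace (quasiSplit (↥(maximalRealSubfield L)) L (IsCMField.complexConj L) 2).Adelic]
variable [MeasurableSpace (arch (↥(maximalRealSubfield L)) L (IsCMField.complexConj L) 2 ((StdForm.antidiagonal 2).over L))] [BorelSpace (arch (↥(maximalRealSubfield L)) L (IsCMField.complexConj L) 2 ((StdForm.antidiagonal 2).over L))]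
variable [MeasurableSpace (finAdelic (↥(maximalRealSubfield L)) L (IsCMField.complexConj L) 2 ((StdForm.antidiagonal 2).over L))] [BorelSpace (finAdelic (↥(maximalRealSubfield L)) L (IsCMField.complexConj L) 2 ((StdForm.antidiagonal 2).over L))]
variable (νG : Measure (quasiSplit (↥(maximalRealSubfield L)) L (IsCMField.complexConj L) 2).Adelic) [νG.IsHaarMeasure]
variable (μa : Measure (arch (↥(maximalRealSubfield L)) L (IsCMField.complexConj L) 2 ((StdForm.antidiagonal 2).over L))) [μa.IsHaarMeasure] [μa.IsMulRightInvariant]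
variable (μf : Measure (finAdelic (↥(maximalRealSubfield L)) L (IsCMField.complexConj L) 2 ((StdForm.antidiagonal 2).over L))) [μf.IsHaarMeasure]
variable {χ : HeckeCharacter L} {K' : Subgroup (quasiSplit (↥(maximalRealSubfield L)) L (IsCMField.complexConj L) 2).Adelic} {ω : ↥K' → ℂ}

include μa μf in
/-- **HEAD `hfam` FOR EVERY `(χ_∞, ω)`** — the letter `hfam` of ★ `K2E1ChiConvDataCMTwo.exists_chi_convData_cm_two` at `V := chiSectionSpace χ K′ ω`: for every `z₀` a symmetric non-negative
`GL₂(𝔸_L)` test function `η = α_ψ ⊗ 𝟙_{U₀}` (archimedean gauge bump × an open compact level inside `K′` on which `ω = 1`) and an ENTIRE `s` with `s z₀ ≠ 0` such that `S_η̃ η̃` acts on every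
`f_z^φ`, `φ ∈ V`, by `s(z)`.  Binders: `K′ ≤ K`, `ι(K_∞) ⊆ K′`, `U₀` open compact with `ι_f(U₀ ∩ G_f) ⊆ K′` and `ω = 1` there, continuous sections, a two-sided Haar measure `μ_∞` on `G_∞`
(and any Haar `μ_f` on `G(𝔸_f)`; both only enter the proof). [cite: Bump1997, proof of Lemma 2.3.2] [cite: BernsteinLapid2019, §4 Claim 1] -/
theorem hfam_gauge_cm_two
    (hK' : K' ≤ ((standardMaximalCompactGL 2 L).comap (adelicVal (↥(maximalRealSubfield L)) L (IsCMField.complexConj L) 2 ((StdForm.antidiagonal 2).over L)) : Subgroup (quasiSplit (↥(maximalRealSubfield L)) L (IsCMField.complexConj L) 2).Adelic))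
    (hKinf : ∀ k : arch (↥(maximalRealSubfield L)) L (IsCMField.complexConj L) 2 ((StdForm.antidiagonal 2).over L), adelicVal (↥(maximalRealSubfield L)) L (IsCMField.complexConj L) 2 ((StdForm.antidiagonal 2).over L) (archToAdelic (↥(maximalRealSubfield L)) L (IsCMField.complexConj L) 2 _ k) ∈ standardMaximalCompactGL 2 L →
      archToAdelic (↥(maximalRealSubfield L)) L (IsCMField.complexConj L) 2 _ k ∈ K')
    (U₀ : Subgroup (GL (Fin 2) (FiniteAdeleRing (𝓞 L) L))) (hU₀o : IsOpen (U₀ : Set (GL (Fin 2) (FiniteAdeleRing (𝓞 L) L)))) (hU₀c : IsCompact (U₀ : Set (GL (Fin 2) (FiniteAdeleRing (𝓞 L) L))))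
    (hU : ∀ b : finAdelic (↥(maximalRealSubfield L)) L (IsCMField.complexConj L) 2 ((StdForm.antidiagonal 2).over L), (b : GL (Fin 2) (FiniteAdeleRing (𝓞 L) L)) ∈ U₀ →
      ∃ hb : finAdelicToAdelic (↥(maximalRealSubfield L)) L (IsCMField.complexConj L) 2 ((StdForm.antidiagonal 2).over L) b ∈ K', ω ⟨_, hb⟩ = 1)
    (hVc : ∀ φ ∈ chiSectionSpace χ K' ω, Continuous φ) :
    ∀ z₀ : ℂ, ∃ η : GL (Fin 2) (AdeleRing (𝓞 L) L) → ℝ, IsTestFunctionGL 2 L η ∧ (∀ g, 0 ≤ η g) ∧ (∀ g, η g⁻¹ = η g) ∧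
      ∃ s : ℂ → ℂ, Differentiable ℂ s ∧ s z₀ ≠ 0 ∧ ∀ z : ℂ, ∀ φ ∈ chiSectionSpace χ K' ω, ∀ x : (quasiSplit (↥(maximalRealSubfield L)) L (IsCMField.complexConj L) 2).Adelic,
        (∫ y, (fun y : (quasiSplit (↥(maximalRealSubfield L)) L (IsCMField.complexConj L) 2).Adelic => orbitalSmoothing νG (fun x : (quasiSplit (↥(maximalRealSubfield L)) L (IsCMField.complexConj L) 2).Adelic => ((η (adelicVal (↥(maximalRealSubfield L)) L (IsCMField.complexConj L) 2 ((StdForm.antidiagonal 2).over L) x) : ℝ) : ℂ)) (fun x : (quasiSplit (↥(maximalRealSubfield L)) L (IsCMField.complexConj L) 2).Adelic => ((η (adelicVal (↥(maximalRealSubfield L)) L (IsCMField.complexConj L) 2 ((StdForm.antidiagonal 2).over L) x) : ℝ) : ℂ)) y) y *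
          flatSectionU φ z (x * y) ∂νG) = s z * flatSectionU φ z x := by
  intro z₀
  have hc2 : IsCMField.complexConj L * IsCMField.complexConj L = 1 := AlgEquiv.ext fun x => IsCMField.complexConj_apply_apply L x
  obtain ⟨ψ, s, hsd, hs0, -, hact⟩ := exists_gauge_symbol_two νG μa μf (IsCMField.complexConj_ne_one L) hc2 (complexConj_smul_infinitePlace L) hK' hKinf U₀ hU₀o hU₀c hU hVc z₀
  exact ⟨fun g => adelicWeight U₀ (archBump ψ) g, isTestFunctionGL_gaugeWeight ψ U₀ hU₀o hU₀c, gaugeWeight_nonneg ψ U₀, gaugeWeight_inv ψ U₀, s, hsd, hs0, hact⟩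

include μa μf in
/-- **HEAD `hnc` FOR EVERY `(χ_∞, ω)`** — the letter `hnc` of ★ `exists_chi_convData_cm_two` at `V := chiSectionSpace χ K′ ω`: ONE such test function whose entire symbol is NON-CONSTANT (second
difference `∫ w·Φ·R^{z−1}(R−1)² ≠ 0`, K2E1-p11's ★ engine, the arch ray).  Same binders as `hfam_gauge_cm_two`. [cite: Bump1997, proof of Lemma 2.3.2] [cite: Langlands1976, §6] -/
theorem hnc_gauge_cm_two
    (hK' : K' ≤ ((standardMaximalCompactGL 2 L).comap (adelicVal (↥(maximalRealSubfield L)) L (IsCMField.complexConj L) 2 ((StdForm.antidiagonal 2).over L)) : Subgroup (quasiSplit (↥(maximalRealSubfield L)) L (IsCMField.complexConj L) 2).Adelic))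
    (hKinf : ∀ k : arch (↥(maximalRealSubfield L)) L (IsCMField.complexConj L) 2 ((StdForm.antidiagonal 2).over L), adelicVal (↥(maximalRealSubfield L)) L (IsCMField.complexConj L) 2 ((StdForm.antidiagonal 2).over L) (archToAdelic (↥(maximalRealSubfield L)) L (IsCMField.complexConj L) 2 _ k) ∈ standardMaximalCompactGL 2 L →
      archToAdelic (↥(maximalRealSubfield L)) L (IsCMField.complexConj L) 2 _ k ∈ K')
    (U₀ : Subgroup (GL (Fin 2) (FiniteAdeleRing (𝓞 L) L))) (hU₀o : IsOpen (U₀ : Set (GL (Fin 2) (FiniteAdeleRing (𝓞 L) L)))) (hU₀c : IsCompact (U₀ : Set (GL (Fin 2) (FiniteAdeleRing (𝓞 L) L))))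
    (hU : ∀ b : finAdelic (↥(maximalRealSubfield L)) L (IsCMField.complexConj L) 2 ((StdForm.antidiagonal 2).over L), (b : GL (Fin 2) (FiniteAdeleRing (𝓞 L) L)) ∈ U₀ →
      ∃ hb : finAdelicToAdelic (↥(maximalRealSubfield L)) L (IsCMField.complexConj L) 2 ((StdForm.antidiagonal 2).over L) b ∈ K', ω ⟨_, hb⟩ = 1)
    (hVc : ∀ φ ∈ chiSectionSpace χ K' ω, Continuous φ) :
    ∃ η : GL (Fin 2) (AdeleRing (𝓞 L) L) → ℝ, IsTestFunctionGL 2 L η ∧ (∀ g, 0 ≤ η g) ∧ (∀ g, η g⁻¹ = η g) ∧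
      ∃ s : ℂ → ℂ, Differentiable ℂ s ∧ (∃ z₁ z₂ : ℂ, s z₁ ≠ s z₂) ∧ ∀ z : ℂ, ∀ φ ∈ chiSectionSpace χ K' ω, ∀ x : (quasiSplit (↥(maximalRealSubfield L)) L (IsCMField.complexConj L) 2).Adelic,
        (∫ y, (fun y : (quasiSplit (↥(maximalRealSubfield L)) L (IsCMField.complexConj L) 2).Adelic => orbitalSmoothing νG (fun x : (quasiSplit (↥(maximalRealSubfield L)) L (IsCMField.complexConj L) 2).Adelic => ((η (adelicVal (↥(maximalRealSubfield L)) L (IsCMField.complexConj L) 2 ((StdForm.antidiagonal 2).over L) x) : ℝ) : ℂ)) (fun x : (quasiSplit (↥(maximalRealSubfield L)) L (IsCMField.complexConj L) 2).Adelic => ((η (adelicVal (↥(maximalRealSubfield L)) L (IsCMField.complexConj L) 2 ((StdForm.antidiagonal 2).over L) x) : ℝ) : ℂ)) y) y *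
          flatSectionU φ z (x * y) ∂νG) = s z * flatSectionU φ z x := by
  have hc2 : IsCMField.complexConj L * IsCMField.complexConj L = 1 := AlgEquiv.ext fun x => IsCMField.complexConj_apply_apply L x
  obtain ⟨ψ, s, hsd, -, hnc, hact⟩ := exists_gauge_symbol_two νG μa μf (IsCMField.complexConj_ne_one L) hc2 (complexConj_smul_infinitePlace L) hK' hKinf U₀ hU₀o hU₀c hU hVc 0
  exact ⟨fun g => adelicWeight U₀ (archBump ψ) g, isTestFunctionGL_gaugeWeight ψ U₀ hU₀o hU₀c, gaugeWeight_nonneg ψ U₀, gaugeWeight_inv ψ U₀, s, hsd, hnc, hact⟩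

end Heads

end Summit.HodgeConjecture.HodgeConjecture.Cruxes.H413.K2E1ArchSymbolCirclePhaseU2
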